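import Literature.AlgebraicGeometry.Morphisms.CechModuleUnit
import Literature.AlgebraicGeometry.Morphisms.CechModuleH2Refinement
import Literature.AlgebraicGeometry.Morphisms.CechModuleH2
import Literature.AlgebraicGeometry.Morphisms.CechH1LerayGluing
import Mathlib.AlgebraicGeometry.Morphisms.Affine
import HarnessLib

/-!
# Pull-back `g^*` of Čech `2`-cocycles of the structure sheaf along a morphism of `A`-schemes, in the module
# Čech complex; compatibility with refinement; affine preimage covers
# (The Stacks Project, Tag 01ED: functoriality of the Čech complex in the pair (space, covering))

Layer `Literature/AlgebraicGeometry/Morphisms`, namespace `Literature.AlgebraicGeometry.Morphisms`.  THEOREMS ONLY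
(no definition, no named fact, no instance).  For a morphism `g : Y → X` of `A`-schemes (`g ≫ f_X = f_Y`) the tree has
the pull-back `g^* = cechComapC0/C1/C2` of the Čech cochains of the STRUCTURE SHEAF to the preimage family
`g⁻¹𝒰 = (g⁻¹U_i)_i`, commuting with `d⁰`, `d¹`, and `cechComapH1` on `Ȟ¹` (★ `Morphisms/CechH1Pullback`); the
structure sheaf as a sheaf of modules `𝒪_X = SheafOfModules.unit X.ringCatSheaf` has the same Čech cochains and
differentials as `Morphisms/CechH1` definitionally (★ `Morphisms/CechModuleUnit`: `MSections_unit`, `cechMD0/1_unit`,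
`CechMH1_unit`), and `Ȟ²(𝒰, M) = cechMZ2 ⧸ cechMB2` exists only in the MODULE Čech complex (★ `Morphisms/CechModuleH2`).
This file supplies the degree-`2` layer of `g^*` in that currency:

* `MSections.res_unit` — restriction of `𝒪_X`-as-a-module is `Sections.res`, and `d²` is the structure-sheaf `cechD2` of
  ★ `Morphisms/CechH1LerayGluing` (definitional bridges, as `cechMD0/1_unit` in `CechModuleUnit` and ★ `CechH1PreimageGluing.cechMD2_unit`);
* **`cechD2_comapC2_apply`** — `g^*` commutes with `d²` componentwise: `(d²(g^*e))_{ijkl} = g^*((d²e)_{ijkl})`, hence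
  **`comapC2_mem_cechMZ2`** / **`comapC2_mem_cechMB2`** — `g^*` maps `2`-cocycles of `𝒪_X` on `𝒰` to `2`-cocycles of
  `𝒪_Y` on `g⁻¹𝒰` and `2`-coboundaries to `2`-coboundaries (`d¹ ∘ g^* = g^* ∘ d¹`, ★ `cechD1_comapC1`), and
  `comapC2_sub_mem_cechMB2`, **`CechMH2.mk_comapC2_eq_of_mk_eq`** — so `g^*` is well defined on classes:
  `[z] = [z'] ⇒ [g^*z] = [g^*z']` in `Ȟ²(g⁻¹𝒰, 𝒪_Y)` (stated on `CechMH2.mk`; the packaged `A`-linear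
  `Ȟ²(𝒰, 𝒪_X) → Ȟ²(g⁻¹𝒰, 𝒪_Y)` is a one-line `Submodule.mapQ` left to a definition-lane sequel);
* **`cechComapC2_refineC2`** — `g^*` commutes with the refinement maps `cechMRefineC2` of `CechModuleH2Refinement`
  (`g⁻¹𝒱` refines `g⁻¹𝒰` by the same map of index sets; degree-`2` companion of ★ `cechComapC1_refineC1`);
* `isAffineOpen_preimageFamily`, `le_iSup_preimageFamily`, `iSup_preimageFamily_eq_top` — for an AFFINE morphism `g`
  (e.g. finite: multiplication by `n` on an abelian scheme) the preimage family of a family of affine opens is a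
  family of affine opens (Mathlib `IsAffineOpen.preimage`), and it covers `g⁻¹` of whatever `𝒰` covers.

Cell `hodgecm-mathlib` (D-0151), F-11 α1 / J4-(iv) road (a′) brick (iv-3) (F0P1b-plan (g0) (R29); F0P1b-p04 (g0) census
`CENSUS-J4iv-Unobstructed.v0` §2): `[n]^*` on `Ȟ²(𝒰, 𝒪_{A_s})` with values on the affine cover `[n]⁻¹𝒰`, to be compared with
`Ȟ²(𝒰, 𝒪)` on the common refinement (★ `CechModuleH2RefinementInjective`).  Generic and count-neutral; HC_CM is proved
only modulo the 7 printed citations until rung 0 closes — nothing here refers to it.  Mathlib searched (pin v4.32):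
`Scheme.Hom.appLE_map`, `Scheme.Hom.map_appLE` (through ★ `Sections.res_comap` / `comap_res`), `IsAffineOpen.preimage`,
`Scheme.Hom.preimage_iSup`, `Scheme.Hom.iSup_preimage_eq_top` (used); Mathlib has no Čech cohomology of schemes.

## References

* The Stacks Project, Tag 01ED (Cohomology, Section 20.9: the Čech complex and its functoriality), Tag 09UY
  (refinements). [StacksProject]
* U. Görtz, T. Wedhorn, *Algebraic Geometry II: Cohomology of Schemes*, Springer Spektrum (2023),
  doi:10.1007/978-3-658-43031-3: (21.16) Def. 21.71, p. 181 (maps of coverings). [GortzWedhorn2023]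
-/

noncomputable section

open CategoryTheory AlgebraicGeometry Limits TopologicalSpace Opposite

universe u v w

namespace Literature.AlgebraicGeometry.Morphisms

variable {A : Type u} [CommRing A] {X Y : Scheme.{u}} (fX : X ⟶ Spec (.of A)) (fY : Y ⟶ Spec (.of A))
  (g : Y ⟶ X) (hg : g ≫ fX = fY)

/-! ## The structure sheaf as a sheaf of modules: restriction -/

/-- Restriction of sections of `𝒪_X` as a sheaf of modules (`SheafOfModules.unit`) is the restriction `Sections.res`
of functions: definitionally (companion of ★ `MSections_unit`, `cechMD0_unit`).
[cite: StacksProject, Tag 01ED (Cohomology, Section 20.9: the Čech complex of `𝒪_X`)] -/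
theorem MSections.res_unit {V W : X.Opens} (h : W ≤ V) (s : Sections fX V) :
    MSections.res fX (SheafOfModules.unit X.ringCatSheaf) h s = Sections.res fX h s := rfl

/-! ## `g^*` on `2`-cochains commutes with `d²`; cocycles and coboundaries -/

section Comap

variable {ι : Type v} (U : ι → X.Opens)

/-- `d²` of `𝒪_X` as a sheaf of modules is the structure-sheaf `cechD2` of `Morphisms/CechH1LerayGluing`: definitionally
(companion of ★ `cechMD0_unit`, `cechMD1_unit`; a private copy of ★ `CechH1PreimageGluing.cechMD2_unit`, not imported to keep
this file light). [folklore] -/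
private theorem cechMD2_unit' {Z : Scheme.{u}} (fZ : Z ⟶ Spec (.of A)) {κ : Type v} (W : κ → Z.Opens) (e : CechC2 fZ W) :
    cechMD2 fZ (SheafOfModules.unit Z.ringCatSheaf) W e = cechD2 fZ W e := rfl

include hg in
/-- **`g^*` commutes with `d²`, componentwise**: `(d²(g^* e))_{ijkl} = g^*((d² e)_{ijkl})` on
`g⁻¹U_i ∩ g⁻¹U_j ∩ g⁻¹U_k ∩ g⁻¹U_l` (structure sheaf). [cite: StacksProject, Tag 01ED (Cohomology, Section 20.9)] -/
theorem cechD2_comapC2_apply (e : CechC2 fX U) (i j k l : ι) :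
    cechD2 fY (preimageFamily g U) (cechComapC2 fX fY g hg U e) i j k l =
      Sections.comap fX fY g hg (fun _ hx => hx) (cechD2 fX U e i j k l) := by
  rw [cechD2_apply, cechD2_apply]
  simp only [cechComapC2_apply, map_sub, map_add, Sections.comap_res]
  erw [Sections.res_comap, Sections.res_comap, Sections.res_comap, Sections.res_comap]
  rfl

include hg in
/-- **`g^*` maps `2`-cocycles of `𝒪_X` on `𝒰` to `2`-cocycles of `𝒪_Y` on `g⁻¹𝒰`** (in the module Čech complex of
`CechModuleH2`, where `Ž²`, `B̌²`, `Ȟ²` live). [cite: StacksProject, Tag 01ED (Cohomology, Section 20.9)] -/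
theorem comapC2_mem_cechMZ2 {e : CechMC2 fX (SheafOfModules.unit X.ringCatSheaf) U}
    (he : e ∈ cechMZ2 fX (SheafOfModules.unit X.ringCatSheaf) U) :
    (cechComapC2 fX fY g hg U e : CechMC2 fY (SheafOfModules.unit Y.ringCatSheaf) (preimageFamily g U)) ∈
      cechMZ2 fY (SheafOfModules.unit Y.ringCatSheaf) (preimageFamily g U) := by
  have he' := (mem_cechMZ2_iff fX _ U e).mp he
  refine (mem_cechMZ2_iff fY _ _ _).mpr ?_
  funext i j k l
  rw [cechMD2_unit', cechD2_comapC2_apply fX fY g hg U e i j k l, ← cechMD2_unit', he']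
  simp only [Pi.zero_apply]
  exact map_zero _

include hg in
/-- **`g^*` maps `2`-coboundaries to `2`-coboundaries** (`d¹ ∘ g^* = g^* ∘ d¹`, ★ `cechD1_comapC1`).
[cite: StacksProject, Tag 01ED (Cohomology, Section 20.9)] -/
theorem comapC2_mem_cechMB2 {e : CechMC2 fX (SheafOfModules.unit X.ringCatSheaf) U}
    (he : e ∈ cechMB2 fX (SheafOfModules.unit X.ringCatSheaf) U) :
    (cechComapC2 fX fY g hg U e : CechMC2 fY (SheafOfModules.unit Y.ringCatSheaf) (preimageFamily g U)) ∈
      cechMB2 fY (SheafOfModules.unit Y.ringCatSheaf) (preimageFamily g U) := by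
  obtain ⟨c, hc⟩ := (mem_cechMB2_iff fX _ U e).mp he
  refine (mem_cechMB2_iff fY _ _ _).mpr ⟨cechComapC1 fX fY g hg U c, ?_⟩
  rw [cechMD1_unit, cechD1_comapC1 fX fY g hg U c, ← cechMD1_unit, hc]

include hg in
/-- `g^*` of two cohomologous `2`-cochains are cohomologous. [cite: StacksProject, Tag 01ED (Cohomology, Section 20.9)] -/
theorem comapC2_sub_mem_cechMB2 {e e' : CechMC2 fX (SheafOfModules.unit X.ringCatSheaf) U}
    (h : e - e' ∈ cechMB2 fX (SheafOfModules.unit X.ringCatSheaf) U) :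
    (cechComapC2 fX fY g hg U e - cechComapC2 fX fY g hg U e' :
        CechMC2 fY (SheafOfModules.unit Y.ringCatSheaf) (preimageFamily g U)) ∈
      cechMB2 fY (SheafOfModules.unit Y.ringCatSheaf) (preimageFamily g U) := by
  have hsub : cechComapC2 fX fY g hg U (e - e') = cechComapC2 fX fY g hg U e - cechComapC2 fX fY g hg U e' :=
    map_sub _ _ _
  exact (congrArg (fun x => x ∈ cechMB2 fY (SheafOfModules.unit Y.ringCatSheaf) (preimageFamily g U)) hsub).mp
    (comapC2_mem_cechMB2 fX fY g hg U h)

include hg in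
/-- **`g^*` is well defined on `Ȟ²`**: if `[z] = [z']` in `Ȟ²(𝒰, 𝒪_X)` then `[g^* z] = [g^* z']` in `Ȟ²(g⁻¹𝒰, 𝒪_Y)`
(class form; the memberships in `Ž²(g⁻¹𝒰, 𝒪_Y)` are `comapC2_mem_cechMZ2`).
[cite: StacksProject, Tag 01ED (Cohomology, Section 20.9)] -/
theorem CechMH2.mk_comapC2_eq_of_mk_eq (z z' : cechMZ2 fX (SheafOfModules.unit X.ringCatSheaf) U)
    (h : CechMH2.mk fX _ U z = CechMH2.mk fX _ U z') :
    CechMH2.mk fY (SheafOfModules.unit Y.ringCatSheaf) (preimageFamily g U)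
        ⟨cechComapC2 fX fY g hg U (z : CechMC2 fX (SheafOfModules.unit X.ringCatSheaf) U),
          comapC2_mem_cechMZ2 fX fY g hg U z.2⟩ =
      CechMH2.mk fY (SheafOfModules.unit Y.ringCatSheaf) (preimageFamily g U)
        ⟨cechComapC2 fX fY g hg U (z' : CechMC2 fX (SheafOfModules.unit X.ringCatSheaf) U),
          comapC2_mem_cechMZ2 fX fY g hg U z'.2⟩ := by
  rw [CechMH2.mk_eq_mk_iff] at h ⊢
  exact comapC2_sub_mem_cechMB2 fX fY g hg U h

include hg in
/-- `g^*` of a `2`-cocycle of class `0` has class `0` (class form). [cite: StacksProject, Tag 01ED (Cohomology, Section 20.9)] -/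
theorem CechMH2.mk_comapC2_eq_zero_of_mk_eq_zero (z : cechMZ2 fX (SheafOfModules.unit X.ringCatSheaf) U)
    (h : CechMH2.mk fX _ U z = 0) :
    CechMH2.mk fY (SheafOfModules.unit Y.ringCatSheaf) (preimageFamily g U)
        ⟨cechComapC2 fX fY g hg U (z : CechMC2 fX (SheafOfModules.unit X.ringCatSheaf) U),
          comapC2_mem_cechMZ2 fX fY g hg U z.2⟩ = 0 := by
  rw [CechMH2.mk_eq_zero_iff] at h ⊢
  exact comapC2_mem_cechMB2 fX fY g hg U h

end Comap

/-! ## `g^*` commutes with refinement on `2`-cochains -/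

section Refine

variable {ι : Type v} {ι' : Type w} (U : ι → X.Opens) (V : ι' → X.Opens) (τ : ι' → ι)
  (hτ : ∀ j, V j ≤ U (τ j))

include hτ in
/-- The preimage family `g⁻¹𝒱` refines `g⁻¹𝒰` by the same map of index sets (a map of coverings in the sense of
Görtz–Wedhorn II (21.16)). [cite: GortzWedhorn2023, (21.16) Def. 21.71 (p. 181)] -/
theorem preimageFamily_le_preimageFamily (j : ι') : preimageFamily g V j ≤ preimageFamily g U (τ j) :=
  fun _ hx => hτ j hx

include hg in
/-- **`g^*` commutes with refinement on `2`-cochains** (`g⁻¹𝒱` refines `g⁻¹𝒰` by the same `τ`; degree-`2` companion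
of ★ `cechComapC1_refineC1`). [cite: GortzWedhorn2023, (21.16) Def. 21.71 (p. 181)] [cite: StacksProject, Tag 09UY] -/
theorem cechComapC2_refineC2 (e : CechMC2 fX (SheafOfModules.unit X.ringCatSheaf) U) :
    cechComapC2 fX fY g hg V (cechMRefineC2 fX (SheafOfModules.unit X.ringCatSheaf) U V τ hτ e) =
      cechMRefineC2 fY (SheafOfModules.unit Y.ringCatSheaf) (preimageFamily g U) (preimageFamily g V) τ
        (preimageFamily_le_preimageFamily g U V τ hτ) (cechComapC2 fX fY g hg U e) := by
  funext j j' j''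
  rw [cechComapC2_apply, cechMRefineC2_apply, cechMRefineC2_apply, cechComapC2_apply, MSections.res_unit,
    MSections.res_unit, Sections.comap_res]
  erw [Sections.res_comap]
  rfl

include hg in
/-- Hence `g^*` of refined `2`-cochains which are cohomologous on `𝒱` are cohomologous on `g⁻¹𝒱` as refined cochains
of `g⁻¹𝒰` (the form in which `g^*` and the refinement maps are composed on the common refinement).
[cite: GortzWedhorn2023, (21.16) Def. 21.71 (p. 181)] -/
theorem refineC2_comapC2_sub_mem_cechMB2 {e e' : CechMC2 fX (SheafOfModules.unit X.ringCatSheaf) U}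
    (h : cechMRefineC2 fX (SheafOfModules.unit X.ringCatSheaf) U V τ hτ e -
      cechMRefineC2 fX (SheafOfModules.unit X.ringCatSheaf) U V τ hτ e' ∈
        cechMB2 fX (SheafOfModules.unit X.ringCatSheaf) V) :
    cechMRefineC2 fY (SheafOfModules.unit Y.ringCatSheaf) (preimageFamily g U) (preimageFamily g V) τ
        (preimageFamily_le_preimageFamily g U V τ hτ)
        (cechComapC2 fX fY g hg U e : CechMC2 fY (SheafOfModules.unit Y.ringCatSheaf) (preimageFamily g U)) -
      cechMRefineC2 fY (SheafOfModules.unit Y.ringCatSheaf) (preimageFamily g U) (preimageFamily g V) τ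
        (preimageFamily_le_preimageFamily g U V τ hτ)
        (cechComapC2 fX fY g hg U e' : CechMC2 fY (SheafOfModules.unit Y.ringCatSheaf) (preimageFamily g U)) ∈
      cechMB2 fY (SheafOfModules.unit Y.ringCatSheaf) (preimageFamily g V) := by
  rw [← cechComapC2_refineC2 fX fY g hg U V τ hτ e, ← cechComapC2_refineC2 fX fY g hg U V τ hτ e']
  exact comapC2_sub_mem_cechMB2 fX fY g hg V h

end Refine

/-! ## Affine morphisms: the preimage family of an affine cover is an affine cover -/

section Affine

variable {ι : Type v} (U : ι → X.Opens)

/-- For an AFFINE morphism `g` (e.g. a finite one) the preimage family of a family of affine opens consists of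
affine opens (Mathlib `IsAffineOpen.preimage`). [cite: StacksProject, Tag 01S8 (affine morphisms: the inverse image of an affine open is affine)] -/
theorem isAffineOpen_preimageFamily [IsAffineHom g] (hU : ∀ i, IsAffineOpen (U i)) (i : ι) :
    IsAffineOpen (preimageFamily g U i) :=
  (hU i).preimage g

/-- The preimage family covers the preimage of what the family covers (functoriality of the Čech complex in the pair
(space, covering)). [cite: StacksProject, Tag 01ED (Cohomology, Section 20.9)] -/
theorem preimage_le_iSup_preimageFamily {W : X.Opens} (hW : W ≤ ⨆ i, U i) :
    g ⁻¹ᵁ W ≤ ⨆ i, preimageFamily g U i := by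
  intro y hy
  have hy' : g.base y ∈ (⨆ i, U i : X.Opens) := hW hy
  rw [← Scheme.Hom.preimage_iSup]
  exact hy'

/-- The preimage family of a cover of `X` covers `Y` (Mathlib `Scheme.Hom.iSup_preimage_eq_top`).
[cite: StacksProject, Tag 01ED (Cohomology, Section 20.9)] -/
theorem iSup_preimageFamily_eq_top (hU : ⨆ i, U i = ⊤) : ⨆ i, preimageFamily g U i = ⊤ :=
  g.iSup_preimage_eq_top hU

end Affine

end Literature.AlgebraicGeometry.Morphisms

end
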